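import Mathlib
import HarnessLib
import HarnessLib.Audit
import Summits.NavierStokesRegularity.Statement
import Literature.Analysis.FluidPDE.ClassicalSolution
import Literature.Analysis.FluidPDE.LerayHopf
import Literature.Analysis.FluidPDE.VectorCalculus
import Literature.Analysis.FluidPDE.SelfSimilar
import Summits.NavierStokesRegularity.NavierStokesRegularity.Theorems.ContinuousAlignmentNoBlowupToClay
import HarnessLib.Audit.Status.Attr

/-!
Route: PlanarFoldFlux

CLOSED (superseded) 2026-08-16T15:59:41Z by planner-plan-lens-NavierStokesRegularity-strengthen-v2-0 — reason: superseded:route-NavierStokesRegularity-SlicedKelvin — superseded by route-NavierStokesRegularity-SlicedKelvin — note: DUPLICATE BY RACE (opener's own close, 9 min after open): route-NavierStokesRegularity-SlicedKelvin (plan-novel seat, opened 2026-08-16T15:46Z, rev 3, crux-only closes native OK) realises the SAME spine card planar-fold-law-unsigned-flux with the same lever (unsigned planar vorticity flux + fold law. The file is kept as the record of this route; refuted decls are indexed as negative knowledge (`ledger negatives`).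

# Route PlanarFoldFlux — Clay (A) with a bounded critical invariant — unsigned planar vorticity flux
and its 1-D fold law

STRENGTHEN lens (inventor's paradox): prove MORE than Clay (A) — prove that the physical solution
never blows up AND carries a
BOUNDED CRITICAL INVARIANT, the unsigned planar vorticity flux Φ_n(c,t) := ∫_{x·n=c} |ω(x,t)·n| dH²
(dimension 0: invariant under
u ↦ λu(λx,λ²t); ∫Φ_n dc = ‖ω·n‖_{L¹} is a-priori bounded by Constantin1990). S⁺ := for every ν>0 and
every classical Leray–Hopf solution
from a rapidly decaying datum on [0,T): sup_{|n|=1, c, t<T} Φ_n(c,t) < ∞ (K1, PlanarFluxBound) and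
bounded planar flux forbids blow-up at T
(K2, BoundedFluxExtends). S⁺ ⇒ NoBlowup ⇒ Clay (A) by the proved shared frame NoBlowupToClay. The
extra structure that makes S⁺ attackable
and the bare summit not: on every FIXED plane transport and vortex stretching cancel identically in
the budget of Φ_n (Kelvin's theorem read
in L¹ on a plane), leaving the 1-D heat operator in the height c, a nodal annihilation term, and ONE
inertial source — folds of vortex lines
pushed through the plane (card planar-fold-law-unsigned-flux, critic-graded new-mechanism
2026-08-16). X = PlanarFluxBound ∧ BoundedFluxExtends.
Lean: `PlanarFluxBound ∧ BoundedFluxExtends` where each conjunct is the one-line Prop of its crux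
block below (elaborated, Sketch.lean rc 0).

## Assembly
Pure logic (sorry-free in Sketch.lean and glue.lean): fix ν, T, u, p with the three hypotheses;
PlanarFluxBound gives the uniform flux bound M,
BoundedFluxExtends turns it into a smooth extension past T; hence no blow-up at any T, and
NoBlowupToClay (proved) gives NavierStokesRegularity.

Rationale: WHY THIS LINE. FOLD LAW (exact; f := ω·n, Z_c := {f=0}∩Π_{n,c}): ∂_tΦ_n = ν∂_c²Φ_n −
2ν∫_{Z_c}|∇f|²/|∇_∥f| dH¹ − 2∫_{Z_c}(u·n)(ω_∥·ν_Z) dH¹ — the transport term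
−∂_c∫(u·n)|f| and the stretching term +∂_c∫(u·n)|f| + (jump on Z_c) cancel (via ∇_∥·ω_∥ = −∂_n f,
div ω = 0), so the only inertial content of
the growth of a critical quantity is the FOLD SOURCE on tangency curves; the 1-D heat kernel in c
supplies exactly the (νt)^{-1/2} that
separates the energy-class a-priori bound ‖ω‖_{L^∞_tL¹} (Constantin1990, dimension −1) from
dimension 0, putting the a-priori side one
half-derivative (L^{2,1}_t of the fold-creation rate) from closure, and the direction-averaged fold
creation is priced by ∫|u||ω||∇ξ|
(coarea; Constantin's direction gradient). Imported: the polarity-inversion-line flux budget of a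
frozen-in field from solar MHD
(doi:10.1086/498638 eqs. (1),(2),(4)) for the kinematics, 1-D parabolic smoothing, Liouville
rigidity for ancient solutions in a NEW hypothesis
class (vorticity uniformly L¹ on planes, scale-invariant hence inherited by blow-up limits;
KNSS2009, SereginSverak2009, arXiv161009464).
None of the 52 open routes slices Kelvin's theorem by a fixed foliation or has an evolution law for
an unsigned vorticity flux: ThreadingFlux
uses an unsigned RADIAL flux through small spheres only as a dichotomy (no law), HardyPointSink
direction-averages plane integrals of |u|²,
DirectionDissipationQuantum/DirectionEnergy use |∇ξ| as an ε-regularity pivot (smallness),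
TautLoopKelvin works with signed circulation at
material loops. Negatives index (3 refuted statements: AdiabaticEddy corrector, SymmetryModuliCount
finite tangent moduli, Blowup Clay
non-uniqueness) is untouched by any item here.

RANKED CRUXES. #2 PlanarFluxBound (crux) — FOLD BUDGET (card K1): for every ν>0, T>0 and every
classical solution (u,p) of unforced NS on ℝ³×[0,T) that is Leray–Hopf from a rapidly decaying
datum, the unsigned planar vorticity flux ∫_{x·n=c}|curl u(t)·n| dH² is bounded uniformly over unit
normals n, heights c and times t<T; by the fold law it suffices that the fold-creation rate S⁺_n
lies in L^{2,1}(0,T) (the half-derivative upgrade of Constantin's L¹ bound). [difficulty: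
open-problem] (why it might fail: critical a-priori bound: fold creation is only known in L^{8/9}_t
(via ∫|u||ω||∇ξ|), not L^{2,1}_t; a vortex sheet swept back and forth through one plane creates flux
with little direction bending; in turbulence Φ*/Φ(0) ~ Re^{1/2}, so only a datum-dependent bound can
hold.) [Constantin1990, Tao2011, KlapperYoung1995, doi:10.1086/498638]
#3 BoundedFluxExtends (crux) — BOUNDED FLUX FORBIDS BLOW-UP (card K2): a classical Leray–Hopf
solution from a rapidly decaying datum on ℝ³×[0,T) whose unsigned planar vorticity flux is bounded
uniformly in (n,c,t<T) extends smoothly past T. Intended proof: the hypothesis is scale-invariant,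
so zooms of a flux-bounded singularity are bounded ancient mild solutions with vorticity uniformly
L¹ on planes (support PlanarFluxLiouville kills them), plus exclusion of fixed-circulation core
collapse; Type-I/DSS blow-up with a −2-homogeneous vorticity tail is excluded at once (log-divergent
flux on planes through the singular point). [difficulty: open-problem] (why it might fail: bounded
planar flux allows arbitrarily thin fixed-circulation tubes (Φ≈Γ), so the crux contains the
exclusion of Kelvin-compatible (fixed-Γ, Type-II) core collapse; no Liouville theorem is known under
an L¹-on-planes hypothesis; L∞-zooms may degenerate to constant flows.) [KNSS2009,
SereginSverak2009, arXiv161009464, BealeKatoMajda1984]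
#9 NoBlowupToClay (support) — shared frame of the positive routes (stmt-NavierStokesRegularity-0055,
proved in tree): if every classical Leray–Hopf solution from a rapidly decaying datum extends past
every T, Fefferman's Clay (A) holds (Kato maximal-time dichotomy + singular point at a finite
maximal time). [difficulty: provable-now] [Leray1934, Fefferman2000]
#9 PlanarFluxLiouville (support) — LIOUVILLE IN THE PLANAR-L¹ CLASS (the rigidity half of
BoundedFluxExtends): a smooth bounded ancient mild solution of NS (ν = 1) on ℝ³×(−∞,0) whose
unsigned planar vorticity flux is bounded uniformly in (n,c,s<0) is spatially constant on every
slice. Corners: planar 2-D ancient flows and parallel shear flows lie in the class and are constant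
by the known 2-D/caloric Liouville theorems; the linear-background (Craik–Criminale) witnesses that
kill vorticity-normalised zooms have infinite planar flux and are outside the class. [difficulty: L]
[KNSS2009, SereginSverak2009, arXiv161009464]
#9 PlanarFluxLocallyBounded (support) — GROUNDING (non-vacuity of the invariant): a classical
Leray–Hopf solution from a rapidly decaying datum on [0,T) has bounded unsigned planar vorticity
flux on every compact subinterval [0,T'] with T' < T (weak–strong uniqueness identifies it with the
physical solution, whose vorticity decays rapidly in space on compact time intervals inside the
lifespan). [difficulty: M] [Leray1934, BealeKatoMajda1984, Constantin1990]

TWO-LAYER PLAN. Foreseen glued splits (nothing filed now): PlanarFluxBound ⇐ FoldLaw (exact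
identity, provable now) → HeatKernelFluxBound (Φ* ≤ Φ*(0) +
(πν)^{-1/2}∫(t−τ)^{-1/2}S⁺_n, provable now) → FoldCreationL21 (the critical estimate) →
PlanarFluxBound; BoundedFluxExtends ⇐ FluxBoundedZoom
(a flux-bounded singularity zooms to a NONCONSTANT bounded ancient mild solution in the planar-L¹
class, incl. the fixed-Γ collapse case) →
PlanarFluxLiouville → BoundedFluxExtends (k ≤ 3, depth 1).

KILL CRITERIA. A blow-up (any ν) refutes NoBlowup and hence one of the two cruxes: with divergent
planar flux it refutes PlanarFluxBound (close
refuted:PlanarFluxBound — the invariant was the wrong strengthening), with bounded flux it refutes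
BoundedFluxExtends (close refuted:BoundedFluxExtends
and hand the flux-bounded witness to the negative routes as a Kelvin-compatible collapse). A
nonconstant smooth bounded ancient mild solution with
bounded planar flux refutes the support PlanarFluxLiouville only — pivot BoundedFluxExtends to 'zoom
limits of flux-bounded singularities' (restate).
NoBlowup proved elsewhere (TypeILiouville.TypeIliouvilleThesis, stmt-0054) moots the route; the fold
law and PlanarFluxLiouville remain of independent value.

NOT DECOMPOSED YET. The fold law itself (nodal curves Z_c, in-plane normal, H¹-integrals; its
ε-regularised form), the heat-kernel inequality (a) and the coarea
price ∫S⁺_n dn ≤ 4π∫|u||ω||∇ξ| are provable-now lemmas that provers attach with --supports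
PlanarFluxBound (definition request below); the
Type-I tail lemma (a −2-homogeneous vorticity tail forces ∫^T (T−τ)^{-1/2}S⁺_n = ∞) and the
fixed-circulation collapse exclusion are layer-2
children of BoundedFluxExtends; no regime split (Type I / Type II) is filed at open.

CHEAPEST FALSIFIER. (i) An explicit nonconstant bounded ancient (e.g. steady or travelling-wave) NS
solution with vorticity uniformly L¹ on all planes would kill
PlanarFluxLiouville and the intended proof of BoundedFluxExtends — checked by hand: constants,
parallel shear/caloric flows and planar 2-D ancient
flows are in the class but constant (KNSS 2-D Liouville, bounded ancient caloric functions);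
Beltrami/ABC and Oseen-type vortices are not ancient
and bounded; Craik–Criminale modes on linear backgrounds have infinite planar flux — no witness
found. (ii) DNS of Kerr antiparallel tubes /
Hou's axisymmetric datum tracking Φ*_n(t) against ‖ω‖_∞ (card kit jobs j004756/j004759 on random
data: Φ* ×1.5–2.0 while ‖ω‖_∞ ×6.6):
Φ* growing like a power of ‖ω‖_∞ in a near-singular scenario would kill the mechanism behind
PlanarFluxBound for that scenario.

NUMBERS. Dimension count: E, ∫∫|∇u|², sup_t‖ω‖_{L¹}, Tao's ‖u‖_{L¹_tL^∞} all have energy scaling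
(dimension −1); Φ* has dimension 0. Turbulence
calibration: Φ* ~ U L² (ε/ν)^{1/2}/U… = Γ·Re^{1/2} with Γ = UL ~ Φ*(0) (finite per datum, unbounded
uniformly in Re). Type-I/DSS profile with
|y|^{-2} vorticity tail: Φ_n ≈ C log(1/(T−t)) on planes through the singular point (log-marginal).
Card numerics (kit j004756, N=96³, Re≈700):
enstrophy ×3.4, ‖ω‖_∞ ×6.6, Φ* ×1.5–2.0; fold creation / annihilation ≈ 1.4–1.8 at the maximising
plane. Items at open: 6 (2 cruxes, 3 supports, assembly).

DEFINITION REQUESTS. `unsignedPlanarFlux (ω : ℝ³ → ℝ³) (n : ℝ³) (c : ℝ) : ℝ≥0∞ := ∫⁻ x in {x | ⟪x,n⟫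
= c}, ‖⟪ω x, n⟫‖ₑ ∂μH[2]` and `foldCreation u ω n c` (the
ε-regularised source ∫(u·n) s_ε'(f) ω_∥·∇_∥f, ε→0) under
Summits/NavierStokesRegularity/NavierStokesRegularity/Theorems — to be filed after open with
`ledger workitem add --kind definition`; the items above inline the flux so they elaborate today
without them.

Novelty: Searches (2026-08-16): local `lit search` (searchd connection reset, rc 1, all session) and
OpenAlex/S2 (HTTP 429) unavailable; `lit search --source arxiv
"Hamilton Ivey pinching Navier-Stokes"` (0); `lit galaxy search --star all` ×4 ("pinching estimate
Navier-Stokes" 0, "enstrophy to energy ratio" 3 irrelevant,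
"finitely many vertical Fourier modes" 0, "analyticity radius Kolmogorov" 0); full read of the 52
open route theses, the 157 idea cards (24 open, 133 closed),
`ledger negatives` (3), barrier catalogue file list; the spine card's own searches and its
mechanism-critic audit (2026-08-16T00:18Z: galaxy intelligent
'unsigned flux through fixed plane…' 30 rows solar MHD only; Welsch doi:10.1086/498638 read p.1103;
Constantin1990 pp.1–4; Tao2011 Prop. 52; KlapperYoung1995).
Nearest prior art found: Constantin1990 (doi:10.1007/bf02096982: sup_t‖ω‖_{L¹} and ∫∫|ω||∇ξ|², no
slicing, keeps ∫|ω||S|); doi:10.1086/498638 and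
doi:10.1023/a:1025679813955 (PIL flux budget of a frozen-in magnetic field — the kinematic part of
the fold source); KlapperYoung1995 (unsigned flux of a
PASSIVE field grows at the topological-entropy rate); doi:10.1103/PhysRevLett.69.2654 (cancellation
exponent of a vorticity component, statistics only);
in-hub: ThreadingFlux (unsigned radial flux through spheres, dichotomy only), card
circulation-density-liouville (ball density, keeps stretching).
Delta: the heat-in-height fold law for VORTICITY under NS on a fixed plane foliation (transport +
stretching cance  [refs: 10.1086/498638, 10.1007/bf02096982:, 10.1023/a:1025679813955, 10.1103/PhysRevLett.69.2654, doi:10.1086/498638, doi:10.1007/bf02096982, doi:10.1023/a, doi:10.1103/PhysRevLett.69.2654, Constantin1990, Tao2011, KlapperYoung1995]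

Barriers (technique_class: sliced-kelvin-unsigned-flux, liouville-rigidity): - technique_class: sliced-kelvin-unsigned-flux, liouville-rigidity
- Literature.Barriers.NavierStokesRegularity.TaoAveragedBlowup: evaded by construction — the fold
law uses pointwise vorticity transport, frozen-in flux and div ω = 0 and is FALSE for Tao's averaged
bilinear forms (no Kelvin theorem), so an argument through PlanarFluxBound cannot prove the (false)
averaged statement; Tao's footnote exempts L¹/L^∞ endpoint information.
- Literature.Barriers.NavierStokesRegularity.EnergySupercriticality: it applies to the goal
(PlanarFluxBound IS a critical a-priori bound); the bet is the dimension count — energy-class input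
(S⁺ ∈ L¹_t, Constantin) plus the (νt)^{-1/2} of the 1-D heat kernel reaches dimension 0 exactly at
the L^{2,1}_t edge, which is not claimed free.
- Literature.Barriers.NavierStokesRegularity.NavierStokesInequalitySingularSolution: evaded — the
law uses the vorticity EQUATION (curl of the hidden force of a Scheffer/Ożański NSI solution enters
the plane budget), so it fails for the NSI class where singular examples live.
- Literature.Barriers.NavierStokesRegularity.LeraySelfSimilarBlowupExclusion: consistent corner —
self-similar profiles are log-marginal for Φ (a −2-homogeneous vorticity tail makes the planar flux
diverge like log(1/(T−t))), so the line reproves rather than contradicts the exclusion.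
- Literature.Barriers.NavierStokesRegularity.AxisymmetricTypeIExclusion: consistent corner —
axisymmetric no-swirl flows have no fold source on meridional planes

History (route lifecycle, newest last):
- 2026-08-16T15:59:41Z · CLOSED superseded — superseded:route-NavierStokesRegularity-SlicedKelvin (planner-plan-lens-NavierStokesRegularity-strengthen-v2-0)

sub-problem: NavierStokesRegularity · status: closed(superseded) · opened planner-plan-lens-NavierStokesRegularity-strengthen-v2-0 2026-08-16T15:54:10Z · rev 0 · ledger route-NavierStokesRegularity-PlanarFoldFlux
GENERATED by the gate from the ledger (D-0016/17). Provers cite these decls: `theorem foo : Summit.NavierStokesRegularity.NavierStokesRegularity.Theses.PlanarFoldFlux.<Decl> := …` in Summits/NavierStokesRegularity/NavierStokesRegularity/Theorems/<Name>.lean.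
-/

namespace Summit.NavierStokesRegularity.NavierStokesRegularity.Theses.PlanarFoldFlux

open scoped BigOperators Topology Manifold Classical MeasureTheory ProbabilityTheory Matrix InnerProductSpace ComplexConjugate ContinuousMap
open Filter Set Function TopologicalSpace MeasureTheory

attribute [summit_statement] _root_.NavierStokesRegularity

open Literature.NS

/-- item stmt-NavierStokesRegularity-15737 · crux · rank 2 · closed · moot by None · by planner
why it might fail: critical a-priori bound: fold creation is only known in L^{8/9}_t (via ∫|u||ω||∇ξ|), not L^{2,1}_t; a vortex sheet swept back and forth through one plane creates flux with little direction bending; in turbulence Φ*/Φ(0) ~ Re^{1/2}, so only a datum-dependent bound can hold.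
sources: Constantin1990, Tao2011, KlapperYoung1995, doi:10.1086/498638
[crux] FOLD BUDGET (card K1): for every ν>0, T>0 and every classical solution (u,p) of unforced NS
on ℝ³×[0,T) that is Leray–Hopf from a rapidly decaying datum, the unsigned planar vorticity flux
∫_{x·n=c}|curl u(t)·n| dH² is bounded uniformly over unit normals n, heights c and times t<T; by the
fold law it suffices that the fold-creation rate S⁺_n lies in L^{2,1}(0,T) (the half-derivative
upgrade of Constantin's L¹ bound). [difficulty: open-problem] -/
@[route_item "route-NavierStokesRegularity-PlanarFoldFlux", crux]
def PlanarFluxBound : Prop :=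
  ∀ (ν T : ℝ), 0 < ν → 0 < T → ∀ (u : ℝ → EuclideanSpace ℝ (Fin 3) → EuclideanSpace ℝ (Fin 3)) (p : ℝ → EuclideanSpace ℝ (Fin 3) → ℝ), Literature.Analysis.FluidPDE.IsClassicalNSSolutionOn (Set.Ico 0 T) ν 0 u p → Literature.Analysis.FluidPDE.IsLerayHopfOn T ν 0 (u 0) u → Literature.Analysis.FluidPDE.HasRapidSpatialDecay (u 0) → ∃ M : NNReal, ∀ t ∈ Set.Ico 0 T, ∀ n : EuclideanSpace ℝ (Fin 3), ‖n‖ = 1 → ∀ c : ℝ, ∫⁻ x in {x : EuclideanSpace ℝ (Fin 3) | inner ℝ x n = c}, ‖inner ℝ (Literature.Analysis.FluidPDE.curl (u t) x) n‖ₑ ∂(MeasureTheory.Measure.hausdorffMeasure 2) ≤ (M : ENNReal)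

/-- item stmt-NavierStokesRegularity-15738 · crux · rank 3 · closed · moot by None · by planner
why it might fail: bounded planar flux allows arbitrarily thin fixed-circulation tubes (Φ≈Γ), so the crux contains the exclusion of Kelvin-compatible (fixed-Γ, Type-II) core collapse; no Liouville theorem is known under an L¹-on-planes hypothesis; L∞-zooms may degenerate to constant flows.
sources: KNSS2009, SereginSverak2009, arXiv161009464, BealeKatoMajda1984
[crux] BOUNDED FLUX FORBIDS BLOW-UP (card K2): a classical Leray–Hopf solution from a rapidly
decaying datum on ℝ³×[0,T) whose unsigned planar vorticity flux is bounded uniformly in (n,c,t<T)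
extends smoothly past T. Intended proof: the hypothesis is scale-invariant, so zooms of a
flux-bounded singularity are bounded ancient mild solutions with vorticity uniformly L¹ on planes
(support PlanarFluxLiouville kills them), plus exclusion of fixed-circulation core collapse;
Type-I/DSS blow-up with a −2-homogeneous vorticity tail is excluded at once (log-divergent flux on
planes through the singular point). [difficulty: open-problem] -/
@[route_item "route-NavierStokesRegularity-PlanarFoldFlux", crux]
def BoundedFluxExtends : Prop :=
  ∀ (ν T : ℝ), 0 < ν → 0 < T → ∀ (u : ℝ → EuclideanSpace ℝ (Fin 3) → EuclideanSpace ℝ (Fin 3)) (p : ℝ → EuclideanSpace ℝ (Fin 3) → ℝ), Literature.Analysis.FluidPDE.IsClassicalNSSolutionOn (Set.Ico 0 T) ν 0 u p → Literature.Analysis.FluidPDE.IsLerayHopfOn T ν 0 (u 0) u → Literature.Analysis.FluidPDE.HasRapidSpatialDecay (u 0) → (∃ M : NNReal, ∀ t ∈ Set.Ico 0 T, ∀ n : EuclideanSpace ℝ (Fin 3), ‖n‖ = 1 → ∀ c : ℝ, ∫⁻ x in {x : EuclideanSpace ℝ (Fin 3) | inner ℝ x n = c}, ‖inner ℝ (Literature.Analysis.FluidPDE.curl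 (u t) x) n‖ₑ ∂(MeasureTheory.Measure.hausdorffMeasure 2) ≤ (M : ENNReal)) → Literature.Analysis.FluidPDE.HasSmoothExtensionPast ν 0 u T

/-- item stmt-NavierStokesRegularity-15607 · support · rank 9 · closed · proved by Summit.NavierStokesRegularity.NavierStokesRegularity.Theorems.continuousAlignment_noBlowupToClay_proof @ 6b20035d4dc4 (prover) · by planner
sources: Leray1934, Fefferman2000
[support] shared local-theory assembly (verbatim stmt-NavierStokesRegularity-0055, PROVED in tree by
Theorems.typeICertificateLadder_noBlowupToClay_proof): NoBlowup → Clay (A). [difficulty: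
provable-now] -/
@[route_item "route-NavierStokesRegularity-PlanarFoldFlux", crux]
def NoBlowupToClay : Prop :=
  (∀ (ν T : ℝ), 0 < ν → 0 < T → ∀ (u : ℝ → EuclideanSpace ℝ (Fin 3) → EuclideanSpace ℝ (Fin 3)) (p : ℝ → EuclideanSpace ℝ (Fin 3) → ℝ), Literature.Analysis.FluidPDE.IsClassicalNSSolutionOn (Set.Ico 0 T) ν 0 u p → Literature.Analysis.FluidPDE.IsLerayHopfOn T ν 0 (u 0) u → Literature.Analysis.FluidPDE.HasRapidSpatialDecay (u 0) → Literature.Analysis.FluidPDE.HasSmoothExtensionPast ν 0 u T) → NavierStokesRegularity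

/-- `NoBlowupToClay` holds: proved by `Summit.NavierStokesRegularity.NavierStokesRegularity.Theorems.continuousAlignment_noBlowupToClay_proof` @ 6b20035d4dc4. -/
theorem NoBlowupToClay_holds : NoBlowupToClay := _root_.Summit.NavierStokesRegularity.NavierStokesRegularity.Theorems.continuousAlignment_noBlowupToClay_proof

/-- item stmt-NavierStokesRegularity-15739 · support · rank 9 · closed · moot by None · by planner
sources: KNSS2009, SereginSverak2009, arXiv161009464
[support] LIOUVILLE IN THE PLANAR-L¹ CLASS (the rigidity half of BoundedFluxExtends): a smooth
bounded ancient mild solution of NS (ν = 1) on ℝ³×(−∞,0) whose unsigned planar vorticity flux is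
bounded uniformly in (n,c,s<0) is spatially constant on every slice. Corners: planar 2-D ancient
flows and parallel shear flows lie in the class and are constant by the known 2-D/caloric Liouville
theorems; the linear-background (Craik–Criminale) witnesses that kill vorticity-normalised zooms
have infinite planar flux and are outside the class. [difficulty: L] -/
@[route_item "route-NavierStokesRegularity-PlanarFoldFlux"]
def PlanarFluxLiouville : Prop :=
  ∀ v : ℝ → EuclideanSpace ℝ (Fin 3) → EuclideanSpace ℝ (Fin 3), Literature.Analysis.FluidPDE.IsBoundedAncientMildSolution 1 v → ContDiffOn ℝ (⊤ : ℕ∞) (Function.uncurry v) (Set.Iio 0 ×ˢ Set.univ) → (∃ M : NNReal, ∀ s < 0, ∀ n : EuclideanSpace ℝ (Fin 3), ‖n‖ = 1 → ∀ c : ℝ, ∫⁻ x in {x : EuclideanSpace ℝ (Fin 3) | inner ℝ x n = c}, ‖inner ℝ (Literature.Analysis.FluidPDE.curl (v s) x) n‖ₑ ∂(MeasureTheory.Measure.hausdorffMeasure 2) ≤ (M : ENNReal)) → ∀ s < 0, ∀ x y, v s x = v s y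

/-- item stmt-NavierStokesRegularity-15740 · support · rank 9 · closed · moot by None · by planner
sources: Leray1934, BealeKatoMajda1984, Constantin1990
[support] GROUNDING (non-vacuity of the invariant): a classical Leray–Hopf solution from a rapidly
decaying datum on [0,T) has bounded unsigned planar vorticity flux on every compact subinterval
[0,T'] with T' < T (weak–strong uniqueness identifies it with the physical solution, whose vorticity
decays rapidly in space on compact time intervals inside the lifespan). [difficulty: M] -/
@[route_item "route-NavierStokesRegularity-PlanarFoldFlux"]
def PlanarFluxLocallyBounded : Prop :=
  ∀ (ν T : ℝ), 0 < ν → 0 < T → ∀ (u : ℝ → EuclideanSpace ℝ (Fin 3) → EuclideanSpace ℝ (Fin 3)) (p : ℝ → EuclideanSpace ℝ (Fin 3) → ℝ), Literature.Analysis.FluidPDE.IsClassicalNSSolutionOn (Set.Ico 0 T) ν 0 u p → Literature.Analysis.FluidPDE.IsLerayHopfOn T ν 0 (u 0) u → Literature.Analysis.FluidPDE.HasRapidSpatialDecay (u 0) → ∀ T' : ℝ, 0 ≤ T' → T' < T → ∃ M : NNReal, ∀ t ∈ Set.Icc 0 T', ∀ n : EuclideanSpace ℝ (Fin 3), ‖n‖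 = 1 → ∀ c : ℝ, ∫⁻ x in {x : EuclideanSpace ℝ (Fin 3) | inner ℝ x n = c}, ‖inner ℝ (Literature.Analysis.FluidPDE.curl (u t) x) n‖ₑ ∂(MeasureTheory.Measure.hausdorffMeasure 2) ≤ (M : ENNReal)

/-- item stmt-NavierStokesRegularity-15741 · assembly · rank 1 · closed · moot by None · by planner
sources: Fefferman2000, KNSS2009
[assembly] PlanarFluxBound → BoundedFluxExtends → NoBlowupToClay → NavierStokesRegularity. -/
@[route_item "route-NavierStokesRegularity-PlanarFoldFlux"]
def Assembly : Prop :=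
  PlanarFluxBound → BoundedFluxExtends → NoBlowupToClay → NavierStokesRegularity

/-! D-0027 §2.1 — DECIDING THEOREM (planner-authored via `route open/edit --closes-file`; by planner-plan-lens-NavierStokesRegularity-strengthen-v2-0 2026-08-16T15:54:10Z) — ARCHIVED: route closed (superseded) 2026-08-16T15:59:41Z; kept so importers keep building:
its hypotheses are this route's items and its conclusion the sub-problem Statement (glue_lint), and it elaborates with this file. -/

@[closes "route-NavierStokesRegularity-PlanarFoldFlux"] theorem closes (hK1 : PlanarFluxBound) (hK2 : BoundedFluxExtends) (hClay : NoBlowupToClay) : NavierStokesRegularity := by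
  apply hClay
  intro ν T hν hT u p hcl hLH hdec
  exact hK2 ν T hν hT u p hcl hLH hdec (hK1 ν T hν hT u p hcl hLH hdec)

end Summit.NavierStokesRegularity.NavierStokesRegularity.Theses.PlanarFoldFlux
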